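import Mathlib
import Summits.Ventures.PercRepro2.Defs
import Summits.Ventures.PercRepro2.Independence
import Summits.Ventures.PercRepro2.Harris
import Summits.Ventures.PercRepro2.ThreeEventSafe
import Summits.Ventures.PercRepro2.ThreeEventCross
import Summits.Ventures.PercRepro2.ThreeEventCertificate
import Summits.Ventures.PercRepro2.ThreeEventCertificateSwap

/-!
# The certificate induction (blind cell PercRepro2, p4 g33; proofs/P4-G33-CROSS.md §4d, conjecture (∃-SYM))

**`defect_nonneg_of_sym_certificates`**: let `P` be any class of quadruples `(G, H, M, B)`. If every
quadruple of the class, at every admissible weight vector with an unpinned edge, has an unpinned edge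
`e`, two quadruples of the class and coefficients `λ₁, λ₂ ≥ 0` such that the symmetrised pointwise
certificate `λ₁ (c₁ + c₁^swap) + λ₂ (c₂ + c₂^swap) ≤ χ + χ^swap` holds on the configurations with `e`
open, then the defect `Cov_p(G, H) − Cov_p(M, B ∩ H)` is nonnegative for every quadruple of the class
and every admissible `p`. Induction on the number of unpinned edges, generalising over the quadruple:
`Ψ_p = a²Ψ_{p[e↦1]} + (1−a)²Ψ_{p[e↦0]} + a(1−a)X_p(e)` with the two section defects nonnegative by the
induction hypothesis and `X_p(e) ≥ λ₁Ψ_{p[e↦1]}(1) + λ₂Ψ_{p[e↦1]}(2) ≥ 0` by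
`crossTerm_ge_of_pointwise_sym` and the induction hypothesis. With `P` = the admissible quadruples
(increasing `G ⊇ M ⊇ G ∩ B`, increasing `H`, decreasing `B`) the hypothesis is exactly the cell's
conjecture (∃-SYM), so the three-event lemma is in the kernel MODULO that finite combinatorial
statement. The symmetrised-certificate lemmas of ThreeEventCertificateSym (p737669) are restated here with a prime
(the olean of that row was not yet served on the farm when this file was checked). No definition, no instance,
no notation.
-/

namespace Summit.Ventures.PercRepro2

namespace ThreeEvent

section Sym

variable {E : Type*} [Fintype E] [DecidableEq E] {R : Type*} [CommRing R]

/-- The cross term as a double sum with the samples swapped. -/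
theorem crossTerm_eq_double_sum_swap' (p : E → R) (e : E) (G H M B : Set (Config E)) :
    crossTerm p e G H M B
      = ∑ ω, ∑ ω', weight (Function.update p e 1) ω * weight (Function.update p e 1) ω'
          * (pairWt G H M B (Function.update ω' e false) ω
              + pairWt G H M B ω' (Function.update ω e false)) := by
  rw [crossTerm_eq_double_sum, Finset.sum_comm]
  refine Finset.sum_congr rfl fun ω _ => Finset.sum_congr rfl fun ω' _ => ?_
  ring

/-- Twice the cross term as the double sum of the symmetrised cross pair weight. -/
theorem two_mul_crossTerm_eq' (p : E → R) (e : E) (G H M B : Set (Config E)) :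
    2 * crossTerm p e G H M B
      = ∑ ω, ∑ ω', weight (Function.update p e 1) ω * weight (Function.update p e 1) ω'
          * ((pairWt G H M B (Function.update ω e false) ω'
              + pairWt G H M B ω (Function.update ω' e false))
            + (pairWt G H M B (Function.update ω' e false) ω
              + pairWt G H M B ω' (Function.update ω e false))) := by
  rw [two_mul]
  nth_rewrite 1 [crossTerm_eq_double_sum]
  rw [crossTerm_eq_double_sum_swap', ← Finset.sum_add_distrib]
  refine Finset.sum_congr rfl fun ω _ => ?_
  rw [← Finset.sum_add_distrib]
  refine Finset.sum_congr rfl fun ω' _ => ?_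
  ring

/-- Twice the defect as the double sum of the symmetrised pair weight. -/
theorem two_mul_defect_eq' (p : E → R) (G H M B : Set (Config E)) :
    2 * defect p G H M B
      = ∑ ω, ∑ ω', weight p ω * weight p ω' * (pairWt G H M B ω ω' + pairWt G H M B ω' ω) := by
  rw [two_mul]
  nth_rewrite 1 [defect_eq_double_sum]
  rw [defect_eq_double_sum_swap, ← Finset.sum_add_distrib]
  refine Finset.sum_congr rfl fun ω _ => ?_
  rw [← Finset.sum_add_distrib]
  refine Finset.sum_congr rfl fun ω' _ => ?_
  ring

end Sym

section Certificate

variable {E : Type*} [Fintype E] [DecidableEq E] {R : Type*} [CommRing R] [LinearOrder R]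
  [IsStrictOrderedRing R]

/-- **Symmetrised pointwise certificates.** If, on configurations with `e` open,
`λ₁ (c₁(ω,ω') + c₁(ω',ω)) + λ₂ (c₂(ω,ω') + c₂(ω',ω)) ≤ χ(ω,ω') + χ(ω',ω)`, then
`2 (λ₁ Ψ_{p[e↦1]}(1) + λ₂ Ψ_{p[e↦1]}(2)) ≤ 2 X_p(e)`. -/
theorem crossTerm_ge_of_pointwise_sym' {p : E → R} (hp : IsProbVec p) (e : E)
    (G H M B G₁ H₁ M₁ B₁ G₂ H₂ M₂ B₂ : Set (Config E)) (l₁ l₂ : R)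
    (hcert : ∀ ω ω' : Config E, ω e = true → ω' e = true →
      l₁ * (pairWt G₁ H₁ M₁ B₁ ω ω' + pairWt G₁ H₁ M₁ B₁ ω' ω)
        + l₂ * (pairWt G₂ H₂ M₂ B₂ ω ω' + pairWt G₂ H₂ M₂ B₂ ω' ω)
        ≤ (pairWt G H M B (Function.update ω e false) ω'
            + pairWt G H M B ω (Function.update ω' e false))
          + (pairWt G H M B (Function.update ω' e false) ω
            + pairWt G H M B ω' (Function.update ω e false))) :
    2 * (l₁ * defect (Function.update p e 1) G₁ H₁ M₁ B₁
      + l₂ * defect (Function.update p e 1) G₂ H₂ M₂ B₂) ≤ 2 * crossTerm p e G H M B := by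
  rw [mul_add, mul_left_comm, mul_left_comm (2 : R), two_mul_defect_eq', two_mul_defect_eq',
    two_mul_crossTerm_eq']
  simp only [Finset.mul_sum]
  rw [← Finset.sum_add_distrib]
  refine Finset.sum_le_sum fun ω _ => ?_
  rw [← Finset.sum_add_distrib]
  refine Finset.sum_le_sum fun ω' _ => ?_
  have hq : IsProbVec (Function.update p e 1) := hp.update e zero_le_one le_rfl
  have hw : 0 ≤ weight (Function.update p e 1) ω * weight (Function.update p e 1) ω' :=
    mul_nonneg (weight_nonneg hq ω) (weight_nonneg hq ω')
  by_cases h : ω e = true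
  · by_cases h' : ω' e = true
    · have := mul_le_mul_of_nonneg_left (hcert ω ω' h h') hw
      linarith [this]
    · have h'' : ω' e = false := by simpa using h'
      rw [weight_update_one_eq_zero_of_false p h'']
      simp
  · have h'' : ω e = false := by simpa using h
    rw [weight_update_one_eq_zero_of_false p h'']
    simp

end Certificate

section Induction

variable {E : Type*} [Fintype E] [DecidableEq E] {R : Type*} [CommRing R] [LinearOrder R]
  [IsStrictOrderedRing R]

/-- **The certificate induction.** -/
theorem defect_nonneg_of_sym_certificates
    (P : Set (Config E) → Set (Config E) → Set (Config E) → Set (Config E) → Prop)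
    (hcert : ∀ (G H M B : Set (Config E)), P G H M B →
      ∀ p : E → R, IsProbVec p → (unpinned p).Nonempty →
        ∃ e ∈ unpinned p, ∃ (G₁ H₁ M₁ B₁ G₂ H₂ M₂ B₂ : Set (Config E)) (l₁ l₂ : R),
          P G₁ H₁ M₁ B₁ ∧ P G₂ H₂ M₂ B₂ ∧ 0 ≤ l₁ ∧ 0 ≤ l₂ ∧
          ∀ ω ω' : Config E, ω e = true → ω' e = true →
            l₁ * (pairWt G₁ H₁ M₁ B₁ ω ω' + pairWt G₁ H₁ M₁ B₁ ω' ω)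
              + l₂ * (pairWt G₂ H₂ M₂ B₂ ω ω' + pairWt G₂ H₂ M₂ B₂ ω' ω)
              ≤ (pairWt G H M B (Function.update ω e false) ω'
                  + pairWt G H M B ω (Function.update ω' e false))
                + (pairWt G H M B (Function.update ω' e false) ω
                  + pairWt G H M B ω' (Function.update ω e false))) :
    ∀ (G H M B : Set (Config E)), P G H M B → ∀ p : E → R, IsProbVec p →
      0 ≤ defect p G H M B := by
  classical
  suffices key : ∀ (n : ℕ) (p : E → R), IsProbVec p → (unpinned p).card = n →
      ∀ (G H M B : Set (Config E)), P G H M B → 0 ≤ defect p G H M B by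
    intro G H M B hP p hp
    exact key _ p hp rfl G H M B hP
  intro n
  induction n using Nat.strong_induction_on with
  | _ n ih =>
    intro p hp hn G H M B hP
    by_cases hne : (unpinned p).Nonempty
    · obtain ⟨e, he, G₁, H₁, M₁, B₁, G₂, H₂, M₂, B₂, l₁, l₂, hP₁, hP₂, hl₁, hl₂, hpt⟩ :=
        hcert G H M B hP p hp hne
      have ha0 : 0 ≤ p e := hp.nonneg e
      have ha1 : 0 ≤ 1 - p e := sub_nonneg.2 (hp.le_one e)
      have hcard : ((unpinned p).erase e).card < n := by
        rw [← hn]; exact Finset.card_erase_lt_of_mem he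
      have hp1 : IsProbVec (Function.update p e 1) := hp.update e zero_le_one le_rfl
      have hp0 : IsProbVec (Function.update p e 0) := hp.update e le_rfl zero_le_one
      have hc1 : (unpinned (Function.update p e 1)).card = ((unpinned p).erase e).card := by
        rw [unpinned_update p he 1 (Or.inr rfl)]
      have hc0 : (unpinned (Function.update p e 0)).card = ((unpinned p).erase e).card := by
        rw [unpinned_update p he 0 (Or.inl rfl)]
      have h1 : 0 ≤ defect (Function.update p e 1) G H M B := ih _ hcard _ hp1 hc1 G H M B hP
      have h0 : 0 ≤ defect (Function.update p e 0) G H M B := ih _ hcard _ hp0 hc0 G H M B hP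
      have hJ1 : 0 ≤ defect (Function.update p e 1) G₁ H₁ M₁ B₁ :=
        ih _ hcard _ hp1 hc1 G₁ H₁ M₁ B₁ hP₁
      have hJ2 : 0 ≤ defect (Function.update p e 1) G₂ H₂ M₂ B₂ :=
        ih _ hcard _ hp1 hc1 G₂ H₂ M₂ B₂ hP₂
      have hX2 := crossTerm_ge_of_pointwise_sym' hp e G H M B G₁ H₁ M₁ B₁ G₂ H₂ M₂ B₂ l₁ l₂ hpt
      have hX : 0 ≤ crossTerm p e G H M B := by
        have := mul_nonneg hl₁ hJ1
        have := mul_nonneg hl₂ hJ2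
        linarith
      rw [defect_eq_pin_cross p G H M B e]
      have := mul_nonneg (mul_nonneg ha0 ha1) hX
      have := mul_nonneg (pow_nonneg ha0 2) h1
      have := mul_nonneg (pow_nonneg ha1 2) h0
      linarith
    · have hpin : ∀ e, p e = 0 ∨ p e = 1 := fun e => by
        by_contra hcon
        refine hne ⟨e, ?_⟩
        simp only [unpinned, Finset.mem_filter, Finset.mem_univ, true_and]
        exact ⟨fun h => hcon (Or.inl h), fun h => hcon (Or.inr h)⟩
      rw [defect_eq_zero_of_pinned p hpin]

/-- **The three-event lemma modulo (∃-SYM)**: for the class of admissible quadruples (increasing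
`G ⊇ M ⊇ G ∩ B`, increasing `H`, decreasing `B`), the hypothesis of the certificate induction gives
`Cov_p(M, B ∩ H) ≤ Cov_p(G, H)` for every admissible quadruple and weight vector. -/
theorem cov_inter_le_cov_of_sym_certificates
    (hcert : ∀ (G H M B : Set (Config E)),
      (IsUpperSet G ∧ IsUpperSet H ∧ IsUpperSet M ∧ IsLowerSet B ∧ M ⊆ G ∧ G ∩ B ⊆ M) →
      ∀ p : E → R, IsProbVec p → (unpinned p).Nonempty →
        ∃ e ∈ unpinned p, ∃ (G₁ H₁ M₁ B₁ G₂ H₂ M₂ B₂ : Set (Config E)) (l₁ l₂ : R),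
          (IsUpperSet G₁ ∧ IsUpperSet H₁ ∧ IsUpperSet M₁ ∧ IsLowerSet B₁ ∧ M₁ ⊆ G₁ ∧ G₁ ∩ B₁ ⊆ M₁)
          ∧ (IsUpperSet G₂ ∧ IsUpperSet H₂ ∧ IsUpperSet M₂ ∧ IsLowerSet B₂ ∧ M₂ ⊆ G₂ ∧ G₂ ∩ B₂ ⊆ M₂)
          ∧ 0 ≤ l₁ ∧ 0 ≤ l₂ ∧
          ∀ ω ω' : Config E, ω e = true → ω' e = true →
            l₁ * (pairWt G₁ H₁ M₁ B₁ ω ω' + pairWt G₁ H₁ M₁ B₁ ω' ω)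
              + l₂ * (pairWt G₂ H₂ M₂ B₂ ω ω' + pairWt G₂ H₂ M₂ B₂ ω' ω)
              ≤ (pairWt G H M B (Function.update ω e false) ω'
                  + pairWt G H M B ω (Function.update ω' e false))
                + (pairWt G H M B (Function.update ω' e false) ω
                  + pairWt G H M B ω' (Function.update ω e false)))
    {G H M B : Set (Config E)} (hG : IsUpperSet G) (hH : IsUpperSet H) (hM : IsUpperSet M)
    (hB : IsLowerSet B) (hMG : M ⊆ G) (hGB : G ∩ B ⊆ M) {p : E → R} (hp : IsProbVec p) :
    prob p (M ∩ (B ∩ H)) - prob p M * prob p (B ∩ H) ≤ prob p (G ∩ H) - prob p G * prob p H :=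
  sub_nonneg.1 (defect_nonneg_of_sym_certificates
    (fun G H M B => IsUpperSet G ∧ IsUpperSet H ∧ IsUpperSet M ∧ IsLowerSet B ∧ M ⊆ G ∧ G ∩ B ⊆ M)
    hcert G H M B ⟨hG, hH, hM, hB, hMG, hGB⟩ p hp)

end Induction

end ThreeEvent

end Summit.Ventures.PercRepro2
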